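import Summits.QuantumFields.YangMills.Theorems.ColdStartUniversalityLatticeLangevinLiebRobinsonSemigroup
import Summits.QuantumFields.YangMills.Theorems.ColdStartUniversalityLatticeLangevinLiebRobinsonOneLinkOscillation
import Summits.QuantumFields.YangMills.Theorems.ColdStartUniversalityLatticeLangevinLiebRobinsonTorusGeometry
import Summits.QuantumFields.YangMills.Theorems.ColdStartUniversalityLatticeLangevinPointwiseMixingUniform
import Mathlib.Analysis.Complex.ExponentialBounds
import HarnessLib

/-!
# Route `ColdStartUniversality` (fixed-cut-off SZZ dynamics; LIEB–ROBINSON / LOCALITY package, file 7):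
# ★★★ EVERY-START MIXING OF LOCAL OBSERVABLES WITH VOLUME-FREE CONSTANTS at `|β'| < 1/12`

Helper file (seat `ym-line-csu-p1`, g30; `--supports stmt-QuantumFields-24809`).  The question left open by the every-start package of g29
(`wilson_pointwise_mixing_of_carre_uniform`: `|κ_t F(x) − μ_(β')F| ≤ π·√#E·e^(−ρt)·σ`, volume-free only for volume-AVERAGED observables) is
answered for LOCAL observables: the `√#E` is removed by locality.  Two per-link Lipschitz bounds for `κ_t F` are combined —
(light cone) the Lieb–Robinson bound `transitionKernel_liebRobinson` with the exponential torus weights `108^{D(e₀,·)}`: the Lipschitz constant of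
`κ_t F` in a link `e₀` at sup-distance `D` from the support `Λ` of `F` is `≤ e^(λt)·(π/(2√2))σ·Σ_(e∈Λ) 108^(−D(e₀,e))`, `λ = (1300 + 4√2)|β'|`;
(curvature) the Bakry–Émery gradient bound `wilson_lipschitz_contraction_uniform` + the one-link oscillation lemma: `≤ (π/(2√2))·e^(−ρt)σ`,
`ρ = 1 − 12|β'|` — summed over all links of the torus with the light-cone split `sum_edge_min_le` (radius `R ≈ (λ+ρ)t/log 2`), telescoping and
invariance of `μ_(β')`:
* ★★★ `wilson_local_pointwise_mixing_uniform` — for every `L`, `|β'| < 1/12`, every realising Markov kernel family `κ`, every `C⁵` `f` with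
  `Γ^A(f) ≤ σ²` on the group such that `f∘coords` depends only on the links in a finite set `Λ`, every `t ≥ 0` and EVERY start `x`:
  `|κ_t(f∘coords)(x) − ∫ f∘coords dμ_(β')| ≤ 3π·#Λ·σ·((3(λ+ρ)t + 1)³ + 2)·e^(−ρt)` — NO dependence on the volume `L`, exponential rate `ρ⁻`:
  a fixed local observable equilibrates from EVERY deterministic start in lattice time `O(ρ⁻¹ log(#Λσ/δ))`, uniformly in `L` (whereas
  general bounded observables need `Θ(log L)`, g27/g28).
THEOREMS ONLY, no definition, no sorry; [folklore] (Lieb–Robinson + Bakry–Émery; the constants `108`, `1300` come from crude ball counts and are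
not optimised).  HONEST FRAMING: fixed cut-off and FIXED `|β'| < 1/12` (lattice units); along the route's scaling `β'_K = (γε_K)⁻¹/2 → ∞` the
window is left and `λ ∝ |β'|` blows up, so nothing here is `K`-uniform; `UniformColdStartMixing` (24809, aside) is NOT restated; no crux, rung or
summit statement is proved; the Yang–Mills mass gap is NOT proved.
-/

set_option autoImplicit false

noncomputable section

namespace Summit.QuantumFields.YangMills.Theorems.ColdStartUniversality.LiebRobinson

open MeasureTheory ProbabilityTheory Matrix Complex Finset Filter Set Metric
open scoped ComplexConjugate BigOperators Matrix NNReal ENNReal Topology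
open Literature.Probability.Process Literature.MathematicalPhysics.QuantumFieldTheory
open Literature.MathematicalPhysics.QuantumFieldTheory.Balaban1983to89
open Literature.MathematicalPhysics.QuantumLattice (fundamentalRep fundamentalLatticeRep continuous_fundamentalRep fundamentalRep_apply)

variable {L : ℕ} [NeZero L]

/-- `(1/2)^(R+1) ≤ e^(−c)` as soon as `R = ⌊c / log 2⌋₊`. [folklore] -/
theorem half_pow_floor_succ_le_exp_neg (c : ℝ) :
    ((2 : ℝ)⁻¹) ^ (⌊c / Real.log 2⌋₊ + 1) ≤ Real.exp (-c) := by
  have hlog : 0 < Real.log 2 := Real.log_pos (by norm_num)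
  have hlt : c / Real.log 2 < (⌊c / Real.log 2⌋₊ : ℝ) + 1 := Nat.lt_floor_add_one _
  have hle : c ≤ ((⌊c / Real.log 2⌋₊ + 1 : ℕ) : ℝ) * Real.log 2 := by
    rw [div_lt_iff₀ hlog] at hlt
    push_cast
    linarith
  have h2 : ((2 : ℝ)⁻¹) ^ (⌊c / Real.log 2⌋₊ + 1) = Real.exp (-(((⌊c / Real.log 2⌋₊ + 1 : ℕ) : ℝ) * Real.log 2)) := by
    rw [Real.exp_neg, Real.exp_nat_mul, Real.exp_log (by norm_num : (0:ℝ) < 2), inv_pow]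
  rw [h2]
  exact Real.exp_le_exp.2 (by linarith)

/-- `2⌊c/log 2⌋₊ + 1 ≤ 3c + 1` for `c ≥ 0` (`log 2 > 2/3`). [folklore] -/
theorem two_mul_floor_add_one_le {c : ℝ} (hc : 0 ≤ c) :
    (2 * (⌊c / Real.log 2⌋₊ : ℝ) + 1) ≤ 3 * c + 1 := by
  have hlog : (0.6931471803 : ℝ) < Real.log 2 := Real.log_two_gt_d9
  have hlog0 : 0 < Real.log 2 := by linarith
  have hfl : (⌊c / Real.log 2⌋₊ : ℝ) ≤ c / Real.log 2 := Nat.floor_le (div_nonneg hc hlog0.le)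
  have h3 : c / Real.log 2 ≤ 3 / 2 * c := by
    rw [div_le_iff₀ hlog0]
    nlinarith
  linarith

/-- ★★★ **EVERY-START MIXING OF LOCAL OBSERVABLES, VOLUME-FREE.**  At `|β'| < 1/12`, for every torus size `L`, every Markov kernel family
`κ` realising the transition laws of the `SU(2)` SZZ dynamics, every `C⁵` function `f` of the real link coordinates with `Γ^A(f) ≤ σ²` on the group
and such that `f∘coords` depends only on the links in the finite set `Λ`, every lattice time `t` and EVERY configuration `x`:
`|κ_t(f∘coords)(x) − ∫ f∘coords dμ_(β')| ≤ 3π·#Λ·σ·((3(λ + ρ)t + 1)³ + 2)·e^(−ρt)`, `ρ = 1 − 12|β'|`, `λ = (1300 + 4√2)|β'|` — independent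
of the volume.  Proof: per-link Lipschitz constants of `κ_t(f∘coords)` from the Lieb–Robinson bound (outside the light cone) and from the
gradient bound + one-link oscillation lemma (inside), telescoping over all links of the torus (`sum_edge_min_le`), invariance of `μ_(β')`.
[folklore] -/
theorem wilson_local_pointwise_mixing_uniform (L : ℕ) [NeZero L] (β' : ℝ) (hβ : |β'| < 1 / 12)
    (κ : ℝ≥0 → Kernel (GaugeConfig 3 L (Matrix.specialUnitaryGroup (Fin 2) ℂ))
      (GaugeConfig 3 L (Matrix.specialUnitaryGroup (Fin 2) ℂ))) [∀ t, IsMarkovKernel (κ t)]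
    (hreal : ∀ (t : ℝ≥0) (x : GaugeConfig 3 L (Matrix.specialUnitaryGroup (Fin 2) ℂ))
        (Ω : Type) [MeasurableSpace Ω] (P : Measure Ω) [IsProbabilityMeasure P]
        (W : ℝ≥0 → Ω → (Edge 3 L × NoiseIdx 2 → ℝ)) (hW : IsFlatBrownian W P)
        (U : ℝ≥0 → Ω → GaugeConfig 3 L (Matrix.specialUnitaryGroup (Fin 2) ℂ)),
        (∀ ω, U 0 ω = x) →
        (latticeLangevinDynamics (fundamentalLatticeRep 2) β').IsSolution (fundamentalRep (Fin 2))
          hW.natFiltration P W U →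
        κ t x = P.map (U t))
    {f : (Edge 3 L × Fin 2 × Fin 2 × Bool → ℝ) → ℝ} (hf : ContDiff ℝ 5 f) {σ : ℝ} (hσ : 0 ≤ σ)
    (Λ : Finset (Edge 3 L)) (t : ℝ≥0) :
    let coords : GaugeConfig 3 L (Matrix.specialUnitaryGroup (Fin 2) ℂ) → (Edge 3 L × Fin 2 × Fin 2 × Bool → ℝ) :=
      fun V q => (fun z : ℂ => if q.2.2.2 then z.im else z.re)
        ((fundamentalRep (Fin 2) (V q.1) : Matrix (Fin 2) (Fin 2) ℂ) q.2.1 q.2.2.1)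
    let A : GaugeConfig 3 L (Matrix.specialUnitaryGroup (Fin 2) ℂ) → (Edge 3 L × Fin 2 × Fin 2 × Bool) →
        (Edge 3 L × Fin 2 × Fin 2 × Bool) → ℝ := fun V i j =>
      ∑ n : Edge 3 L × NoiseIdx 2,
        (if n.1 = i.1 then (fun z : ℂ => if i.2.2.2 then z.im else z.re)
          ((latticeLangevinDynamics (fundamentalLatticeRep 2) β').noise
            (matrixConfig (fundamentalRep (Fin 2)) V) i.1 n.2 i.2.1 i.2.2.1) else 0) *
        (if n.1 = j.1 then (fun z : ℂ => if j.2.2.2 then z.im else z.re)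
          ((latticeLangevinDynamics (fundamentalLatticeRep 2) β').noise
            (matrixConfig (fundamentalRep (Fin 2)) V) j.1 n.2 j.2.1 j.2.2.1) else 0)
    (∀ y, (∑ i : Edge 3 L × Fin 2 × Fin 2 × Bool, ∑ j : Edge 3 L × Fin 2 × Fin 2 × Bool, fderiv ℝ f (coords y) (Pi.single i 1) * fderiv ℝ f (coords y) (Pi.single j 1) * A y i j) ≤ σ ^ 2) →
    (∀ y y' : GaugeConfig 3 L (Matrix.specialUnitaryGroup (Fin 2) ℂ), (∀ e ∈ Λ, y e = y' e) → f (coords y) = f (coords y')) →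
    ∀ x, |∫ y, f (coords y) ∂(κ t x) - ∫ y, f (coords y) ∂(wilsonMeasure (d := 3) (L := L) (fundamentalRep (Fin 2)) β')| ≤
      3 * Real.pi * Λ.card * σ *
        ((3 * (((1300 + 4 * Real.sqrt 2) * |β'| + (1 - 12 * |β'|)) * (t : ℝ)) + 1) ^ 3 + 2) *
          Real.exp (-((1 - 12 * |β'|) * (t : ℝ))) := by
  intro coords A hΓ hloc x
  classical
  haveI := secondCountableTopology_su2
  haveI := borelSpace_config L
  haveI : IsProbabilityMeasure (wilsonMeasure (d := 3) (L := L) (fundamentalRep (Fin 2)) β') :=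
    isProbabilityMeasure_wilsonMeasure (d := 3) (L := L) (fundamentalRep (Fin 2)) (continuous_fundamentalRep (Fin 2)) β'
  have hco : Continuous coords := continuous_coords (L := L)
  -- abbreviations for the constants
  set ρ : ℝ := 1 - 12 * |β'| with hρ
  set lam : ℝ := |β'| * (4 + 4 * Real.sqrt 2 + 12 * 108) with hlam
  have hlam' : lam = (1300 + 4 * Real.sqrt 2) * |β'| := by rw [hlam]; ring
  have hρpos : 0 < ρ := by rw [hρ]; linarith
  have hlam0 : 0 ≤ lam := by rw [hlam]; positivity
  set σt : ℝ := Real.exp (-(ρ * (t : ℝ))) * σ with hσt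
  have hσt0 : 0 ≤ σt := mul_nonneg (Real.exp_pos _).le hσ
  set cπ : ℝ := Real.pi / (2 * Real.sqrt 2) with hcπ
  have hcπ0 : 0 ≤ cπ := by rw [hcπ]; positivity
  -- (1) the representative of `κ_t F` and its carré du champ bound
  obtain ⟨g, hg, -, hgrep, hbound⟩ := wilson_lipschitz_contraction_uniform L β' hβ κ hreal hf t hΓ
  have hgrep' : ∀ y : GaugeConfig 3 L (Matrix.specialUnitaryGroup (Fin 2) ℂ), ∫ z, f (coords z) ∂(κ t y) = g (coords y) :=
    fun y => hgrep y
  have he : Real.exp (-(2 * (1 - 12 * |β'|) * (t : ℝ))) * σ ^ 2 = σt ^ 2 := by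
    rw [hσt, mul_pow, sq (Real.exp (-(ρ * (t : ℝ)))), ← Real.exp_add, hρ]
    congr 1; congr 1; ring
  have hΓg : ∀ y, (∑ i : Edge 3 L × Fin 2 × Fin 2 × Bool, ∑ j : Edge 3 L × Fin 2 × Fin 2 × Bool, fderiv ℝ g (coords y) (Pi.single i 1) * fderiv ℝ g (coords y) (Pi.single j 1) * A y i j) ≤ σt ^ 2 := fun y => by
    have h := hbound y
    rw [he] at h
    exact h
  -- (2) curvature: the one-link Lipschitz constant `cπ·σt` of `κ_t F` in EVERY link
  have hB : ∀ (e₀ : Edge 3 L) (y y' : GaugeConfig 3 L (Matrix.specialUnitaryGroup (Fin 2) ℂ)), (∀ e, e ≠ e₀ → y e = y' e) →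
      |g (coords y) - g (coords y')| ≤ cπ * σt * frobNorm ((y e₀ : Matrix (Fin 2) (Fin 2) ℂ) - (y' e₀ : Matrix (Fin 2) (Fin 2) ℂ)) := by
    intro e₀ y y' hyy'
    have h := oscillation_oneLink_le_of_carre_le L β' (hg.of_le (by norm_num)) hσt0 e₀ hΓg y' y
      (fun e he => hyy' e he)
    rw [hcπ]; exact h
  -- (3) light cone: the Lieb–Robinson Lipschitz constant of `κ_t F` in the link `e₀`
  have cF : Continuous fun y : GaugeConfig 3 L (Matrix.specialUnitaryGroup (Fin 2) ℂ) => f (coords y) := hf.continuous.comp hco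
  set ℓ : Edge 3 L → ℝ := fun e => if e ∈ Λ then cπ * σ else 0 with hℓ
  have hℓ0 : ∀ e, 0 ≤ ℓ e := fun e => by
    simp only [hℓ]; split_ifs
    · exact mul_nonneg hcπ0 hσ
    · exact le_rfl
  have hFlip : ∀ (e : Edge 3 L) (y y' : GaugeConfig 3 L (Matrix.specialUnitaryGroup (Fin 2) ℂ)), (∀ e', e' ≠ e → y e' = y' e') →
      |f (coords y) - f (coords y')| ≤ ℓ e * frobNorm ((y e : Matrix (Fin 2) (Fin 2) ℂ) - (y' e : Matrix (Fin 2) (Fin 2) ℂ)) := by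
    intro e y y' hyy'
    by_cases heΛ : e ∈ Λ
    · simp only [hℓ, heΛ, if_true]
      have h := oscillation_oneLink_le_of_carre_le L β' (hf.of_le (by norm_num)) hσ e hΓ y' y (fun e' he' => hyy' e' he')
      rw [hcπ]; exact h
    · simp only [hℓ, heΛ, if_false, zero_mul]
      have hagree : ∀ e' ∈ Λ, y e' = y' e' := fun e' he' => hyy' e' (fun h => heΛ (h ▸ he'))
      rw [hloc y y' hagree, sub_self, abs_zero]
  -- the torus weight centred at `e₀`
  have hA : ∀ (e₀ : Edge 3 L) (y y' : GaugeConfig 3 L (Matrix.specialUnitaryGroup (Fin 2) ℂ)), (∀ e, e ≠ e₀ → y e = y' e) →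
      |g (coords y) - g (coords y')| ≤
        (Real.exp (lam * (t : ℝ)) * (cπ * σ) *
          ∑ e ∈ Λ, ((108 : ℝ)⁻¹) ^ (Finset.univ.sup fun i : Fin 3 => ((e.1 i - e₀.1 i).valMinAbs).natAbs)) *
          frobNorm ((y e₀ : Matrix (Fin 2) (Fin 2) ℂ) - (y' e₀ : Matrix (Fin 2) (Fin 2) ℂ)) := by
    intro e₀ y y' hyy'
    set w : Edge 3 L → ℝ := fun e => (108 : ℝ) ^ (Finset.univ.sup fun i : Fin 3 => ((e.1 i - e₀.1 i).valMinAbs).natAbs) with hw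
    have hwpos : ∀ e, 0 < w e := fun e => by rw [hw]; positivity
    have hwadm := weight_pow_torusDist_admissible (L := L) e₀.1 (K := (108 : ℝ)) (by norm_num)
    have hLR := transitionKernel_liebRobinson L β' κ hreal w hwpos 108 (by norm_num)
      (fun e j hj => hwadm e j hj) cF ℓ hℓ0 hFlip t y y'
    rw [hgrep' y, hgrep' y'] at hLR
    -- the right-hand side: only the link `e₀` differs, `w e₀ = 1`
    have hsum : ∑ f' : Edge 3 L, w f' * frobNorm ((y f' : Matrix (Fin 2) (Fin 2) ℂ) - (y' f' : Matrix (Fin 2) (Fin 2) ℂ)) =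
        frobNorm ((y e₀ : Matrix (Fin 2) (Fin 2) ℂ) - (y' e₀ : Matrix (Fin 2) (Fin 2) ℂ)) := by
      rw [Finset.sum_eq_single e₀]
      · have hw0 : w e₀ = 1 := by rw [hw]; simp only [torusDist_self, pow_zero]
        rw [hw0, one_mul]
      · intro f' _ hf'
        rw [hyy' f' hf', sub_self, frobNorm_zero, mul_zero]
      · intro h; exact absurd (Finset.mem_univ _) h
    have hratio : ∑ e : Edge 3 L, ℓ e / w e =
        (cπ * σ) * ∑ e ∈ Λ, ((108 : ℝ)⁻¹) ^ (Finset.univ.sup fun i : Fin 3 => ((e.1 i - e₀.1 i).valMinAbs).natAbs) := by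
      rw [Finset.mul_sum]
      rw [← Finset.sum_subset (Finset.subset_univ Λ) (fun e _ he => by simp only [hℓ, he, if_false, zero_div])]
      refine Finset.sum_congr rfl fun e he => ?_
      simp only [hℓ, he, if_true, hw, inv_pow]
      rw [div_eq_mul_inv]
    rw [hsum, hratio] at hLR
    rw [hlam]
    calc |g (coords y) - g (coords y')|
        ≤ Real.exp (|β'| * (4 + 4 * Real.sqrt 2 + 12 * 108) * (t : ℝ)) *
            ((cπ * σ) * ∑ e ∈ Λ, ((108 : ℝ)⁻¹) ^ (Finset.univ.sup fun i : Fin 3 => ((e.1 i - e₀.1 i).valMinAbs).natAbs)) *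
            frobNorm ((y e₀ : Matrix (Fin 2) (Fin 2) ℂ) - (y' e₀ : Matrix (Fin 2) (Fin 2) ℂ)) := hLR
      _ = _ := by ring
  -- (4) the combined per-link profile and telescoping over all links
  set a : ℝ := Real.exp (lam * (t : ℝ)) * (cπ * σ) with ha
  have ha0 : 0 ≤ a := by rw [ha]; positivity
  set S : Edge 3 L → ℝ := fun e₀ => ∑ e ∈ Λ, ((108 : ℝ)⁻¹) ^ (Finset.univ.sup fun i : Fin 3 => ((e.1 i - e₀.1 i).valMinAbs).natAbs)
    with hS
  have hS0 : ∀ e₀, 0 ≤ S e₀ := fun e₀ => Finset.sum_nonneg fun e _ => by positivity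
  set ℓ' : Edge 3 L → ℝ := fun e₀ => min (a * S e₀) (cπ * σt) with hℓ'
  have hℓ'0 : ∀ e₀, 0 ≤ ℓ' e₀ := fun e₀ => le_min (mul_nonneg ha0 (hS0 e₀)) (mul_nonneg hcπ0 hσt0)
  have hGlip : ∀ (e₀ : Edge 3 L) (y y' : GaugeConfig 3 L (Matrix.specialUnitaryGroup (Fin 2) ℂ)), (∀ e, e ≠ e₀ → y e = y' e) →
      |g (coords y) - g (coords y')| ≤ ℓ' e₀ * frobNorm ((y e₀ : Matrix (Fin 2) (Fin 2) ℂ) - (y' e₀ : Matrix (Fin 2) (Fin 2) ℂ)) := by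
    intro e₀ y y' hyy'
    rw [hℓ', min_mul_of_nonneg _ _ (frobNorm_nonneg _)]
    exact le_min (by have h := hA e₀ y y' hyy'; rw [ha, hS]; exact h) (hB e₀ y y' hyy')
  have htel : ∀ y y' : GaugeConfig 3 L (Matrix.specialUnitaryGroup (Fin 2) ℂ),
      |g (coords y) - g (coords y')| ≤ 2 * Real.sqrt 2 * ∑ e₀ : Edge 3 L, ℓ' e₀ := by
    intro y y'
    have h := abs_sub_le_sum_linkLipschitz (F := fun z => g (coords z)) ℓ' hGlip y y'
    refine h.trans ?_
    rw [Finset.mul_sum]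
    refine Finset.sum_le_sum fun e₀ _ => ?_
    have hd : frobNorm ((y e₀ : Matrix (Fin 2) (Fin 2) ℂ) - (y' e₀ : Matrix (Fin 2) (Fin 2) ℂ)) ≤ 2 * Real.sqrt 2 := by
      have h2 := frobNorm_sub_le_of_mem_unitaryGroup (Matrix.specialUnitaryGroup_le_unitaryGroup (y e₀).2)
        (Matrix.specialUnitaryGroup_le_unitaryGroup (y' e₀).2)
      rw [Fintype.card_fin] at h2
      exact_mod_cast h2
    calc ℓ' e₀ * frobNorm ((y e₀ : Matrix (Fin 2) (Fin 2) ℂ) - (y' e₀ : Matrix (Fin 2) (Fin 2) ℂ)) ≤ ℓ' e₀ * (2 * Real.sqrt 2) :=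
          mul_le_mul_of_nonneg_left hd (hℓ'0 e₀)
      _ = 2 * Real.sqrt 2 * ℓ' e₀ := by ring
  -- (5) the light-cone split of `Σ_{e₀} ℓ'(e₀)`
  set R : ℕ := ⌊((lam + ρ) * (t : ℝ)) / Real.log 2⌋₊ with hR
  have hsumℓ' : ∑ e₀ : Edge 3 L, ℓ' e₀ ≤ Λ.card * (3 * (2 * R + 1) ^ 3 * (cπ * σt) + 6 * a * ((2 : ℝ)⁻¹) ^ (R + 1)) := by
    -- `min(a·Σ_e q_e, B) ≤ Σ_e min(a·q_e, B)` and swap the sums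
    have h1 : ∀ e₀ : Edge 3 L, ℓ' e₀ ≤ ∑ e ∈ Λ,
        min (a * ((108 : ℝ)⁻¹) ^ (Finset.univ.sup fun i : Fin 3 => ((e.1 i - e₀.1 i).valMinAbs).natAbs)) (cπ * σt) := by
      intro e₀
      simp only [hℓ', hS, Finset.mul_sum]
      exact min_sum_le_sum_min Λ _ (fun e _ => by positivity) (mul_nonneg hcπ0 hσt0)
    calc ∑ e₀ : Edge 3 L, ℓ' e₀
        ≤ ∑ e₀ : Edge 3 L, ∑ e ∈ Λ,
            min (a * ((108 : ℝ)⁻¹) ^ (Finset.univ.sup fun i : Fin 3 => ((e.1 i - e₀.1 i).valMinAbs).natAbs)) (cπ * σt) :=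
          Finset.sum_le_sum fun e₀ _ => h1 e₀
      _ = ∑ e ∈ Λ, ∑ e₀ : Edge 3 L,
            min (a * ((108 : ℝ)⁻¹) ^ (Finset.univ.sup fun i : Fin 3 => ((e₀.1 i - e.1 i).valMinAbs).natAbs)) (cπ * σt) := by
          rw [Finset.sum_comm]
          refine Finset.sum_congr rfl fun e _ => Finset.sum_congr rfl fun e₀ _ => ?_
          rw [torusDist_comm]
      _ ≤ ∑ _e ∈ Λ, (3 * (2 * R + 1) ^ 3 * (cπ * σt) + 6 * a * ((2 : ℝ)⁻¹) ^ (R + 1)) :=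
          Finset.sum_le_sum fun e _ => sum_edge_min_le e.1 ha0 (mul_nonneg hcπ0 hσt0) R
      _ = Λ.card * (3 * (2 * R + 1) ^ 3 * (cπ * σt) + 6 * a * ((2 : ℝ)⁻¹) ^ (R + 1)) := by
          rw [Finset.sum_const, nsmul_eq_mul]
  -- (6) the choice of `R`: `(1/2)^(R+1) e^{λt} ≤ e^{-ρt}` and `2R+1 ≤ 3(λ+ρ)t + 1`
  have hct : 0 ≤ (lam + ρ) * (t : ℝ) := mul_nonneg (by linarith) t.2
  have hRexp : ((2 : ℝ)⁻¹) ^ (R + 1) ≤ Real.exp (-((lam + ρ) * (t : ℝ))) := half_pow_floor_succ_le_exp_neg _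
  have hR3 : (2 * (R : ℝ) + 1) ≤ 3 * ((lam + ρ) * (t : ℝ)) + 1 := two_mul_floor_add_one_le hct
  have htail : 6 * a * ((2 : ℝ)⁻¹) ^ (R + 1) ≤ 6 * (cπ * σt) := by
    have h1 : a * ((2 : ℝ)⁻¹) ^ (R + 1) ≤ a * Real.exp (-((lam + ρ) * (t : ℝ))) := mul_le_mul_of_nonneg_left hRexp ha0
    have h2 : a * Real.exp (-((lam + ρ) * (t : ℝ))) = cπ * σt := by
      rw [ha, hσt]
      have : Real.exp (lam * (t : ℝ)) * Real.exp (-((lam + ρ) * (t : ℝ))) = Real.exp (-(ρ * (t : ℝ))) := by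
        rw [← Real.exp_add]; congr 1; ring
      calc Real.exp (lam * (t : ℝ)) * (cπ * σ) * Real.exp (-((lam + ρ) * (t : ℝ)))
          = (cπ * σ) * (Real.exp (lam * (t : ℝ)) * Real.exp (-((lam + ρ) * (t : ℝ)))) := by ring
        _ = cπ * (Real.exp (-(ρ * (t : ℝ))) * σ) := by rw [this]; ring
    linarith
  have hcube : (3 * (2 * (R : ℝ) + 1) ^ 3 * (cπ * σt)) ≤ 3 * (3 * ((lam + ρ) * (t : ℝ)) + 1) ^ 3 * (cπ * σt) := by
    have h0 : 0 ≤ 2 * (R : ℝ) + 1 := by positivity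
    have hp : (2 * (R : ℝ) + 1) ^ 3 ≤ (3 * ((lam + ρ) * (t : ℝ)) + 1) ^ 3 := pow_le_pow_left₀ h0 hR3 3
    exact mul_le_mul_of_nonneg_right (mul_le_mul_of_nonneg_left hp (by norm_num)) (mul_nonneg hcπ0 hσt0)
  have hsumℓ'' : ∑ e₀ : Edge 3 L, ℓ' e₀ ≤ Λ.card * ((3 * (3 * ((lam + ρ) * (t : ℝ)) + 1) ^ 3 + 6) * (cπ * σt)) := by
    refine hsumℓ'.trans ?_
    have hcard : (0 : ℝ) ≤ Λ.card := Nat.cast_nonneg _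
    have : 3 * (2 * (R : ℝ) + 1) ^ 3 * (cπ * σt) + 6 * a * ((2 : ℝ)⁻¹) ^ (R + 1) ≤
        (3 * (3 * ((lam + ρ) * (t : ℝ)) + 1) ^ 3 + 6) * (cπ * σt) := by nlinarith
    calc (Λ.card : ℝ) * (3 * (2 * R + 1) ^ 3 * (cπ * σt) + 6 * a * ((2 : ℝ)⁻¹) ^ (R + 1))
        = (Λ.card : ℝ) * (3 * (2 * (R : ℝ) + 1) ^ 3 * (cπ * σt) + 6 * a * ((2 : ℝ)⁻¹) ^ (R + 1)) := by ring
      _ ≤ Λ.card * ((3 * (3 * ((lam + ρ) * (t : ℝ)) + 1) ^ 3 + 6) * (cπ * σt)) := mul_le_mul_of_nonneg_left this hcard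
  -- (7) invariance of `μ_(β')`: `|κ_t F(x) − μF| ≤ sup_{x'} |κ_t F(x) − κ_t F(x')|`
  obtain ⟨C, hC⟩ : ∃ C, ∀ y : (GaugeConfig 3 L (Matrix.specialUnitaryGroup (Fin 2) ℂ)), |f (coords y)| ≤ C := by
    obtain ⟨C, hC⟩ := isCompact_univ.exists_bound_of_continuousOn cF.continuousOn
    exact ⟨C, fun y => by simpa [Real.norm_eq_abs] using hC y (Set.mem_univ y)⟩
  have hinv : ∫ x', (∫ y, f (coords y) ∂(κ t x')) ∂(wilsonMeasure (d := 3) (L := L) (fundamentalRep (Fin 2)) β') =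
      ∫ y, f (coords y) ∂(wilsonMeasure (d := 3) (L := L) (fundamentalRep (Fin 2)) β') :=
    integral_transitionKernel_integral_eq_wilson β' κ hreal t cF.measurable ⟨C, hC⟩
  have hmean : ∫ x', g (coords x') ∂(wilsonMeasure (d := 3) (L := L) (fundamentalRep (Fin 2)) β') =
      ∫ y, f (coords y) ∂(wilsonMeasure (d := 3) (L := L) (fundamentalRep (Fin 2)) β') :=
    (integral_congr_ae (ae_of_all _ fun x' => (hgrep' x').symm)).trans hinv
  have hI : Integrable (fun x' : (GaugeConfig 3 L (Matrix.specialUnitaryGroup (Fin 2) ℂ)) => g (coords x'))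
      (wilsonMeasure (d := 3) (L := L) (fundamentalRep (Fin 2)) β') :=
    integrable_of_continuous_of_compactSpace (hg.continuous.comp hco) _
  have hdiff : g (coords x) - ∫ y, f (coords y) ∂(wilsonMeasure (d := 3) (L := L) (fundamentalRep (Fin 2)) β') =
      ∫ x', (g (coords x) - g (coords x')) ∂(wilsonMeasure (d := 3) (L := L) (fundamentalRep (Fin 2)) β') := by
    rw [integral_sub (integrable_const _) hI, integral_const, smul_eq_mul, probReal_univ, one_mul, hmean]
  rw [hgrep' x, hdiff]
  have hn := norm_integral_le_of_norm_le_const (μ := (wilsonMeasure (d := 3) (L := L) (fundamentalRep (Fin 2)) β'))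
    (f := fun x' : (GaugeConfig 3 L (Matrix.specialUnitaryGroup (Fin 2) ℂ)) => g (coords x) - g (coords x'))
    (C := 2 * Real.sqrt 2 * ∑ e₀ : Edge 3 L, ℓ' e₀)
    (ae_of_all _ fun x' => by rw [Real.norm_eq_abs]; exact htel x x')
  rw [probReal_univ, mul_one, Real.norm_eq_abs] at hn
  refine hn.trans ?_
  -- (8) final arithmetic
  have h22 : 2 * Real.sqrt 2 * (cπ * σt) = Real.pi * σ * Real.exp (-(ρ * (t : ℝ))) := by
    rw [hcπ, hσt]
    have hs : Real.sqrt 2 ≠ 0 := Real.sqrt_ne_zero'.2 (by norm_num)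
    field_simp
  calc 2 * Real.sqrt 2 * ∑ e₀ : Edge 3 L, ℓ' e₀
      ≤ 2 * Real.sqrt 2 * (Λ.card * ((3 * (3 * ((lam + ρ) * (t : ℝ)) + 1) ^ 3 + 6) * (cπ * σt))) :=
        mul_le_mul_of_nonneg_left hsumℓ'' (by positivity)
    _ = 3 * Real.pi * Λ.card * σ * ((3 * ((lam + ρ) * (t : ℝ)) + 1) ^ 3 + 2) * Real.exp (-(ρ * (t : ℝ))) := by
        have : 2 * Real.sqrt 2 * (Λ.card * ((3 * (3 * ((lam + ρ) * (t : ℝ)) + 1) ^ 3 + 6) * (cπ * σt))) =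
            Λ.card * ((3 * (3 * ((lam + ρ) * (t : ℝ)) + 1) ^ 3 + 6)) * (2 * Real.sqrt 2 * (cπ * σt)) := by ring
        rw [this, h22]; ring
    _ = 3 * Real.pi * Λ.card * σ *
          ((3 * (((1300 + 4 * Real.sqrt 2) * |β'| + (1 - 12 * |β'|)) * (t : ℝ)) + 1) ^ 3 + 2) *
            Real.exp (-((1 - 12 * |β'|) * (t : ℝ))) := by
        rw [hlam', hρ]


/-- ★★★ **Every-start mixing of local observables ALONG EVERY SZZ SOLUTION, volume-free.**  At `|β'| < 1/12`: for every torus size `L`, every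
filtered probability space carrying a flat Brownian driver, every strong solution `U` of the `SU(2)` SZZ Langevin SDE from a deterministic start
`U_0 ≡ x₀` (e.g. the COLD start), every `C⁵` `f` with `Γ^A(f) ≤ σ²` whose pull-back `f∘coords` depends only on the links in `Λ`, and every `t`:
`|E[f(coords U_t)] − ∫ f∘coords dμ_(β')| ≤ 3π·#Λ·σ·((3(λ+ρ)t + 1)³ + 2)·e^(−ρt)` — a bound that does not see the volume. [folklore] -/
theorem wilson_solution_local_pointwise_mixing_uniform (L : ℕ) [NeZero L] (β' : ℝ) (hβ : |β'| < 1 / 12) (t : ℝ≥0)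
    (x₀ : GaugeConfig 3 L (Matrix.specialUnitaryGroup (Fin 2) ℂ))
    (Ω : Type) [MeasurableSpace Ω] (P : Measure Ω) [IsProbabilityMeasure P]
    (W : ℝ≥0 → Ω → (Edge 3 L × NoiseIdx 2 → ℝ)) (hW : IsFlatBrownian W P)
    (U : ℝ≥0 → Ω → GaugeConfig 3 L (Matrix.specialUnitaryGroup (Fin 2) ℂ)) (hU0 : ∀ ω, U 0 ω = x₀)
    (hU : (latticeLangevinDynamics (fundamentalLatticeRep 2) β').IsSolution (fundamentalRep (Fin 2)) hW.natFiltration P W U)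
    {f : (Edge 3 L × Fin 2 × Fin 2 × Bool → ℝ) → ℝ} (hf : ContDiff ℝ 5 f) {σ : ℝ} (hσ : 0 ≤ σ) (Λ : Finset (Edge 3 L)) :
    let coords : GaugeConfig 3 L (Matrix.specialUnitaryGroup (Fin 2) ℂ) → (Edge 3 L × Fin 2 × Fin 2 × Bool → ℝ) :=
      fun V q => (fun z : ℂ => if q.2.2.2 then z.im else z.re)
        ((fundamentalRep (Fin 2) (V q.1) : Matrix (Fin 2) (Fin 2) ℂ) q.2.1 q.2.2.1)
    let A : GaugeConfig 3 L (Matrix.specialUnitaryGroup (Fin 2) ℂ) → (Edge 3 L × Fin 2 × Fin 2 × Bool) →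
        (Edge 3 L × Fin 2 × Fin 2 × Bool) → ℝ := fun V i j =>
      ∑ n : Edge 3 L × NoiseIdx 2,
        (if n.1 = i.1 then (fun z : ℂ => if i.2.2.2 then z.im else z.re)
          ((latticeLangevinDynamics (fundamentalLatticeRep 2) β').noise
            (matrixConfig (fundamentalRep (Fin 2)) V) i.1 n.2 i.2.1 i.2.2.1) else 0) *
        (if n.1 = j.1 then (fun z : ℂ => if j.2.2.2 then z.im else z.re)
          ((latticeLangevinDynamics (fundamentalLatticeRep 2) β').noise
            (matrixConfig (fundamentalRep (Fin 2)) V) j.1 n.2 j.2.1 j.2.2.1) else 0)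
    (∀ y, (∑ i : Edge 3 L × Fin 2 × Fin 2 × Bool, ∑ j : Edge 3 L × Fin 2 × Fin 2 × Bool, fderiv ℝ f (coords y) (Pi.single i 1) * fderiv ℝ f (coords y) (Pi.single j 1) * A y i j) ≤ σ ^ 2) →
    (∀ y y' : GaugeConfig 3 L (Matrix.specialUnitaryGroup (Fin 2) ℂ), (∀ e ∈ Λ, y e = y' e) → f (coords y) = f (coords y')) →
    |∫ ω, f (coords (U t ω)) ∂P - ∫ y, f (coords y) ∂(wilsonMeasure (d := 3) (L := L) (fundamentalRep (Fin 2)) β')| ≤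
      3 * Real.pi * Λ.card * σ *
        ((3 * (((1300 + 4 * Real.sqrt 2) * |β'| + (1 - 12 * |β'|)) * (t : ℝ)) + 1) ^ 3 + 2) *
          Real.exp (-((1 - 12 * |β'|) * (t : ℝ))) := by
  intro coords A hΓ hloc
  classical
  haveI := secondCountableTopology_su2
  haveI := borelSpace_config L
  obtain ⟨κ, hκ, -, hreal⟩ := exists_transitionKernel L β'
  haveI := hκ
  have h := wilson_local_pointwise_mixing_uniform L β' hβ κ hreal hf hσ Λ t hΓ hloc x₀
  have hlaw : κ t x₀ = P.map (U t) := hreal t x₀ Ω P W hW U hU0 hU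
  have hmU : Measurable (U t) := (hU.adapted t).mono (hW.natFiltration.le t) le_rfl
  have hFm : Measurable fun y : GaugeConfig 3 L (Matrix.specialUnitaryGroup (Fin 2) ℂ) => f (coords y) :=
    (hf.continuous.comp (continuous_coords (L := L))).measurable
  have e1 : ∫ y, f (coords y) ∂(κ t x₀) = ∫ ω, f (coords (U t ω)) ∂P := by
    rw [hlaw, integral_map hmU.aemeasurable hFm.aestronglyMeasurable]
  rw [← e1]
  exact h

end Summit.QuantumFields.YangMills.Theorems.ColdStartUniversality.LiebRobinson
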